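import Summits.ValiantsHypothesis.ValiantsHypothesis.Theorems.SymPencilPerFourPeeledCornerSwapSamePair
import Summits.ValiantsHypothesis.ValiantsHypothesis.Theorems.SymPencilPerFourPeeledCornerGenSwapRelations

/-!
# Route `SymPencil` — `2 | 2` inner rank of `per_4`, PEELED case at `≤ 11` squares: the
# GENERALIZED-SWAP CORNER on the SAME pair is EMPTY off the locus `u₀u₁ + w₀w₁ = 0` (`--supports`
# stmt-ValiantsHypothesis-5674 `SdcSuperquadratic`; (8,8) column, cell (8,8,11); memo
# `NOTE-p6g16-5674-corner-double-swap.md` §2–§3 with four parameters;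
# `NOTE-p8g15-5674-R2-two-pencil.md` §9.6 "the one known gap")

**Theorem** (`false_of_double_genswap_same_pair`).  There is no reduced peeled family on `≤ 11`
squares (non-zero weights) whose two corrections are GENERALIZED swaps on the same pair,
`ψ(a,x) = u₀a₀x₁ + w₀a₁x₀`, `ψ'(b,x) = u₁b₀x₁ + w₁b₁x₀` (`u₀w₀u₁w₁ ≠ 0`), provided
`u₀u₁ + w₀w₁ ≠ 0`.  Proof as in `…CornerSwapSamePair` (val-lit-p6 g16): the eleven vectors
`μ₁₁, μ₀₀, μ₀₁, μ₁₀, μ₂₃, μ₁₃, μ₀₃, μ₁₂, μ₀₂, v₀, v₀'` are linearly independent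
(`linearIndependent_eleven_genswap`; the only parameter-dependent step is the `3 × 3` block
`{μ₀₁, μ₁₀, μ₂₃}` against `{ν₀₁, ν₁₀, ν₂₃}`, of determinant `λ(u₀u₁ + w₀w₁)/4` — ON the locus the
flattening has rank `8` (exact computation) and this route does not apply), hence span, hence the
four relations (`relations_of_span_genswap`), and `…CornerGenSwapRelations` finishes.  The pure swap
is `u = w` (locus value `2u₀u₁ ≠ 0`), so this contains `false_of_double_swap_same_pair`.

Honest framing: corner bookkeeping absorbing the exceptional-ratio generalized swaps of the coverage
programme; no cell closes; `28 ≤ sdc(per_4) ≤ 29` of record, the crux `SdcSuperquadratic` and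
`VP ≠ VNP` untouched.  Gram bookkeeping after val-lit-p8 g15's `…TwoPencilDesign`.  No definitions,
no named facts. [folklore]
-/

noncomputable section

-- single-conjunct layout: Sub = Summit, duplicated namespace component intended
set_option linter.dupNamespace false

namespace Summit.ValiantsHypothesis.ValiantsHypothesis.Theorems.SymPencilPerFourPeeledCornerGenSwapSamePair

open Matrix Finset Module
open Summit.ValiantsHypothesis.ValiantsHypothesis.Theorems.SymPencilPerFourInnerRankRows
open Summit.ValiantsHypothesis.ValiantsHypothesis.Theorems.SymPencilPerFourInnerRankTenPairs
open Summit.ValiantsHypothesis.ValiantsHypothesis.Theorems.SymPencilPerFourInnerRankScalarBlock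
open Summit.ValiantsHypothesis.ValiantsHypothesis.Theorems.SymPencilPerFourInnerRankReducedFamily
open Summit.ValiantsHypothesis.ValiantsHypothesis.Theorems.SymPencilPerFourPeeledFrame
open Summit.ValiantsHypothesis.ValiantsHypothesis.Theorems.SymPencilPerFourPeeledTwoPencilDesign
open Summit.ValiantsHypothesis.ValiantsHypothesis.Theorems.SymPencilPerFourPeeledTenCaseA
open Summit.ValiantsHypothesis.ValiantsHypothesis.Theorems.SymPencilPerFourPeeledCornerSwap
open Summit.ValiantsHypothesis.ValiantsHypothesis.Theorems.SymPencilPerFourPeeledCornerSwapSamePair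
open Summit.ValiantsHypothesis.ValiantsHypothesis.Theorems.SymPencilPerFourPeeledCornerGenSwapRelations

universe u v

variable {K : Type u} [Field K]

/-- **Eleven independent vectors** (memo §2b): `μ₁₁, μ₀₀, μ₀₁, μ₁₀, μ₂₃, μ₁₃, μ₀₃, μ₁₂, μ₀₂, v₀,
v₀'`, by the triangular pairing pattern against `ν₀₀, ν₁₁, ν₀₂, ν₁₂, ν₀₃, ν₁₃, ν₂₃, ν₀₁, ν₁₀, v₀', v₀`.
[folklore] -/
theorem linearIndependent_eleven_genswap [CharZero K] {κ : Type v} [Fintype κ] [DecidableEq κ]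
    (c : κ → K) (N M : Fin 4 → Fin 4 → κ → K) (v₀ v₀' : κ → K) (u₀ w₀ u₁ w₁ : K)
    (hNMf : ∀ a b y z : Fin 4, ∑ r, c r * N b y r * M a z r =
      (if (a ≠ b ∧ a ≠ y ∧ a ≠ z ∧ b ≠ y ∧ b ≠ z ∧ y ≠ z) then (1 / 2 : K) else 0) -
      (u₀ * (Pi.single a 1 : Fin 4 → K) 0 * (Pi.single y 1 : Fin 4 → K) 1 +
        w₀ * (Pi.single a 1 : Fin 4 → K) 1 * (Pi.single y 1 : Fin 4 → K) 0) *
      (u₁ * (Pi.single b 1 : Fin 4 → K) 0 * (Pi.single z 1 : Fin 4 → K) 1 +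
        w₁ * (Pi.single b 1 : Fin 4 → K) 1 * (Pi.single z 1 : Fin 4 → K) 0) *
      ∑ r, c r * v₀ r * v₀' r)
    (hNv0 : ∀ b y : Fin 4, ∑ r, c r * N b y r * v₀ r = 0)
    (hNv0' : ∀ b y : Fin 4, ∑ r, c r * N b y r * v₀' r = 0)
    (hv0M : ∀ a z : Fin 4, ∑ r, c r * v₀ r * M a z r = 0)
    (hv0'M : ∀ a z : Fin 4, ∑ r, c r * v₀' r * M a z r = 0)
    (hv0v0 : ∑ r, c r * v₀ r * v₀ r = 0) (hv0'v0' : ∑ r, c r * v₀' r * v₀' r = 0)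
    (hu₀ : u₀ ≠ 0) (hw₀ : w₀ ≠ 0) (hu₁ : u₁ ≠ 0) (hw₁ : w₁ ≠ 0) (hloc : u₀ * u₁ + w₀ * w₁ ≠ 0)
    (hlam : ∑ r, c r * v₀ r * v₀' r ≠ 0) :
    LinearIndependent K (![M 1 1, M 0 0, M 0 1, M 1 0, M 2 3, M 1 3, M 0 3, M 1 2, M 0 2, v₀, v₀'] : Fin 11 → κ → K) := by
  classical
  have hv0'v0 : ∑ r, c r * v₀' r * v₀ r = ∑ r, c r * v₀ r * v₀' r := wdot_comm _ _ _
  rw [Fintype.linearIndependent_iff]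
  intro g hg
  have key : ∀ τ : κ → K, ∑ j, g j * ∑ r, c r * τ r * (![M 1 1, M 0 0, M 0 1, M 1 0, M 2 3, M 1 3, M 0 3, M 1 2, M 0 2, v₀, v₀'] : Fin 11 → κ → K) j r = 0 := by
    intro τ
    have e : ∑ j, g j * ∑ r, c r * τ r * (![M 1 1, M 0 0, M 0 1, M 1 0, M 2 3, M 1 3, M 0 3, M 1 2, M 0 2, v₀, v₀'] : Fin 11 → κ → K) j r =
        ∑ r, c r * τ r * (∑ j, g j • (![M 1 1, M 0 0, M 0 1, M 1 0, M 2 3, M 1 3, M 0 3, M 1 2, M 0 2, v₀, v₀'] : Fin 11 → κ → K) j) r := by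
      simp only [Finset.sum_apply, Pi.smul_apply, smul_eq_mul, Finset.mul_sum]
      rw [Finset.sum_comm]
      exact Finset.sum_congr rfl fun r _ => Finset.sum_congr rfl fun j _ => by ring
    rw [e, hg]
    simp
  set lam := ∑ r, c r * v₀ r * v₀' r with hlamdef
  have T0 : g 0 = 0 := by
    have h := key (N 0 0)
    simpa [Fin.sum_univ_succ, Matrix.cons_val_zero, Matrix.cons_val_succ, hNMf, hNv0, hNv0', hu₁, hw₀,
      hlam] using h
  have T1 : g 1 = 0 := by
    have h := key (N 1 1)
    simpa [Fin.sum_univ_succ, Matrix.cons_val_zero, Matrix.cons_val_succ, hNMf, hNv0, hNv0', hu₀, hw₁,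
      hlam] using h
  have T2 : g 5 = 0 := by
    have h := key (N 0 2)
    simpa [Fin.sum_univ_succ, Matrix.cons_val_zero, Matrix.cons_val_succ, hNMf, hNv0, hNv0'] using h
  have T3 : g 6 = 0 := by
    have h := key (N 1 2)
    simpa [Fin.sum_univ_succ, Matrix.cons_val_zero, Matrix.cons_val_succ, hNMf, hNv0, hNv0'] using h
  have T4 : g 7 = 0 := by
    have h := key (N 0 3)
    simpa [Fin.sum_univ_succ, Matrix.cons_val_zero, Matrix.cons_val_succ, hNMf, hNv0, hNv0'] using h
  have T5 : g 8 = 0 := by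
    have h := key (N 1 3)
    simpa [Fin.sum_univ_succ, Matrix.cons_val_zero, Matrix.cons_val_succ, hNMf, hNv0, hNv0'] using h
  have T6 : g 2 * (1 / 2 : K) + g 3 * (1 / 2 : K) = 0 := by
    have h := key (N 2 3)
    simp [Fin.sum_univ_succ, Matrix.cons_val_zero, Matrix.cons_val_succ, hNMf, hNv0, hNv0',
      -mul_eq_zero] at h
    linear_combination h
  have T7 : g 2 * (-(u₀ * u₁ * lam)) + g 4 * (1 / 2 : K) = 0 := by
    have h := key (N 0 1)
    simp [Fin.sum_univ_succ, Matrix.cons_val_zero, Matrix.cons_val_succ, hNMf, hNv0, hNv0',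
      -mul_eq_zero] at h
    linear_combination h
  have T8 : g 3 * (-(w₀ * w₁ * lam)) + g 4 * (1 / 2 : K) = 0 := by
    have h := key (N 1 0)
    simp [Fin.sum_univ_succ, Matrix.cons_val_zero, Matrix.cons_val_succ, hNMf, hNv0, hNv0',
      -mul_eq_zero] at h
    linear_combination h
  have T9 : g 9 = 0 := by
    have h := key v₀'
    simpa [Fin.sum_univ_succ, Matrix.cons_val_zero, Matrix.cons_val_succ, hv0'M, hv0'v0', hv0'v0,
      hlam] using h
  have T10 : g 10 = 0 := by
    have h := key v₀
    simpa [Fin.sum_univ_succ, Matrix.cons_val_zero, Matrix.cons_val_succ, hv0M, hv0v0, ← hlamdef,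
      hlam] using h
  have g2 : g 2 = 0 := by
    have h : g 2 * (lam * (u₀ * u₁ + w₀ * w₁)) = 0 := by
      linear_combination (-1 : K) * T7 + T8 + (2 * w₀ * w₁ * lam) * T6
    exact (mul_eq_zero.1 h).resolve_right (mul_ne_zero hlam hloc)
  have g3 : g 3 = 0 := by linear_combination (2 : K) * T6 - g2
  have g4 : g 4 = 0 := by linear_combination (2 : K) * T7 + (2 * u₀ * u₁ * lam) * g2
  intro i
  fin_cases i
  exacts [T0, T1, g2, g3, g4, T2, T3, T4, T5, T9, T10]

/-- **The four relations** (memo §2c): with the eleven vectors spanning `K^κ`, every left-kernel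
combination `ν₂₀ − ν₀₂, ν₂₁ − ν₁₂, ν₃₁ − ν₁₃, ν₃₂ − ν₂₃` is orthogonal to all of them, hence zero.
[folklore] -/
theorem relations_of_span_genswap [CharZero K] {κ : Type v} [Fintype κ] [DecidableEq κ]
    (c : κ → K) (N M : Fin 4 → Fin 4 → κ → K) (v₀ v₀' : κ → K) (u₀ w₀ u₁ w₁ : K)
    (hNMf : ∀ a b y z : Fin 4, ∑ r, c r * N b y r * M a z r =
      (if (a ≠ b ∧ a ≠ y ∧ a ≠ z ∧ b ≠ y ∧ b ≠ z ∧ y ≠ z) then (1 / 2 : K) else 0) -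
      (u₀ * (Pi.single a 1 : Fin 4 → K) 0 * (Pi.single y 1 : Fin 4 → K) 1 +
        w₀ * (Pi.single a 1 : Fin 4 → K) 1 * (Pi.single y 1 : Fin 4 → K) 0) *
      (u₁ * (Pi.single b 1 : Fin 4 → K) 0 * (Pi.single z 1 : Fin 4 → K) 1 +
        w₁ * (Pi.single b 1 : Fin 4 → K) 1 * (Pi.single z 1 : Fin 4 → K) 0) *
      ∑ r, c r * v₀ r * v₀' r)
    (hNv0 : ∀ b y : Fin 4, ∑ r, c r * N b y r * v₀ r = 0)
    (hNv0' : ∀ b y : Fin 4, ∑ r, c r * N b y r * v₀' r = 0)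

    (hc : ∀ r, c r ≠ 0)
    (hspan : Submodule.span K (Set.range (![M 1 1, M 0 0, M 0 1, M 1 0, M 2 3, M 1 3, M 0 3, M 1 2, M 0 2, v₀, v₀'] : Fin 11 → κ → K)) = ⊤) :
    (∀ r, N 2 0 r = N 0 2 r) ∧ (∀ r, N 2 1 r = N 1 2 r) ∧ (∀ r, N 3 1 r = N 1 3 r) ∧
      (∀ r, N 3 2 r = N 2 3 r) := by
  classical
  have wsub : ∀ x y w : κ → K, ∑ r, c r * (x - y) r * w r =
      ∑ r, c r * x r * w r - ∑ r, c r * y r * w r := fun x y w => by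
    rw [← Finset.sum_sub_distrib]; exact Finset.sum_congr rfl fun r _ => by rw [Pi.sub_apply]; ring
  have rel : ∀ b y : Fin 4, (∀ j, ∑ r, c r * (N b y - N y b) r *
      (![M 1 1, M 0 0, M 0 1, M 1 0, M 2 3, M 1 3, M 0 3, M 1 2, M 0 2, v₀, v₀'] : Fin 11 → κ → K) j r = 0) → ∀ r, N b y r = N y b r := by
    intro b y h r
    have hz := eq_zero_of_orth_span c hc _ hspan _ h
    have := congr_fun hz r
    rw [Pi.sub_apply, Pi.zero_apply, sub_eq_zero] at this
    exact this
  refine ⟨rel 2 0 fun j => ?_, rel 2 1 fun j => ?_, rel 3 1 fun j => ?_, rel 3 2 fun j => ?_⟩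
  all_goals
    fin_cases j <;> (rw [wsub]; simp [hNMf, hNv0, hNv0'])

/-- **The generalized-swap corner on the same pair is empty off the locus.**  See the module
docstring. [folklore] -/
theorem false_of_double_genswap_same_pair [CharZero K] {κ : Type v} [Fintype κ] [DecidableEq κ]
    (hκ : Fintype.card κ ≤ 11) (c : κ → K) (hc : ∀ r, c r ≠ 0)
    (t : κ → (((Fin 4 → K) × (Fin 4 → K)) →ₗ[K] ((Fin 4 → K) × (Fin 4 → K)) →ₗ[K] K))
    (hJ : ∀ a b y₂ y₃ : Fin 4 → K,
      ∑ r, c r * (t r (a, b) (y₂, y₃)) ^ 2 = (Matrix.of ![a, b, y₂, y₃]).permanent)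
    (v₀ v₀' : κ → K) (hv₀ : ∀ (a x : Fin 4 → K), ∃ s : K, (fun r => t r (a, 0) (x, 0)) = s • v₀)
    (hv₀' : ∀ (b x : Fin 4 → K), ∃ s : K, (fun r => t r (0, b) (0, x)) = s • v₀')
    (hpeel : ∃ a b y z : Fin 4 → K, ∑ r, c r * t r (a, 0) (y, 0) * t r (0, b) (0, z) ≠ 0)
    (u₀ w₀ u₁ w₁ : K) (hu₀ : u₀ ≠ 0) (hw₀ : w₀ ≠ 0) (hu₁ : u₁ ≠ 0) (hw₁ : w₁ ≠ 0)
    (hloc : u₀ * u₁ + w₀ * w₁ ≠ 0)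
    (hψ : ∀ (a x : Fin 4 → K) r, t r (a, 0) (x, 0) = (u₀ * a 0 * x 1 + w₀ * a 1 * x 0) * v₀ r)
    (hψ' : ∀ (b x : Fin 4 → K) r, t r (0, b) (0, x) = (u₁ * b 0 * x 1 + w₁ * b 1 * x 0) * v₀' r) :
    False := by
  have hpeel0 := hpeel
  classical
  -- ===== Gram bookkeeping, verbatim after `…TwoPencilDesign.twelve_le_card_of_frame` =====
  have t00 : ∀ r (p : (Fin 4 → K) × (Fin 4 → K)), t r ((0 : Fin 4 → K), (0 : Fin 4 → K)) p = 0 :=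
    fun r p => by rw [show ((0 : Fin 4 → K), (0 : Fin 4 → K)) = (0 : (Fin 4 → K) × (Fin 4 → K))
      from rfl, map_zero, LinearMap.zero_apply]
  have t00' : ∀ r (p : (Fin 4 → K) × (Fin 4 → K)), t r p ((0 : Fin 4 → K), (0 : Fin 4 → K)) = 0 :=
    fun r p => by rw [show ((0 : Fin 4 → K), (0 : Fin 4 → K)) = (0 : (Fin 4 → K) × (Fin 4 → K))
      from rfl, map_zero]
  obtain ⟨a', b', yy, zz, hne⟩ := hpeel
  have hv0facts : (∑ r, c r * v₀ r ^ 2 = 0) ∧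
      (∀ (a y : Fin 4 → K), ∑ r, c r * v₀ r * t r (a, 0) (0, y) = 0) ∧
      (∀ (b x : Fin 4 → K), ∑ r, c r * v₀ r * t r (0, b) (x, 0) = 0) := by
    rcases scalar_block_dichotomy c t hJ v₀ hv₀ with hz | h
    · exact absurd (Finset.sum_eq_zero fun r _ => by rw [hz a' yy r]; ring) hne
    · exact h
  obtain ⟨hQv, hA₃, hB₂⟩ := hv0facts
  set tS : κ → (((Fin 4 → K) × (Fin 4 → K)) →ₗ[K] ((Fin 4 → K) × (Fin 4 → K)) →ₗ[K] K) :=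
    fun r => ((t r).compl₁₂ (LinearEquiv.prodComm K (Fin 4 → K) (Fin 4 → K)).toLinearMap
      LinearMap.id).compl₂ (LinearEquiv.prodComm K (Fin 4 → K) (Fin 4 → K)).toLinearMap with htS
  have hJS : ∀ a b y₂ y₃ : Fin 4 → K,
      ∑ r, c r * (tS r (a, b) (y₂, y₃)) ^ 2 = (Matrix.of ![a, b, y₂, y₃]).permanent :=
    hJ_yswap c _ (hJ_swap c t hJ)
  have htSap : ∀ r (a b y₂ y₃ : Fin 4 → K), tS r (a, b) (y₂, y₃) = t r (b, a) (y₃, y₂) :=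
    fun r a b y₂ y₃ => by simp [htS]
  have hv0'facts : (∑ r, c r * v₀' r ^ 2 = 0) ∧
      (∀ (b y : Fin 4 → K), ∑ r, c r * v₀' r * t r (0, b) (y, 0) = 0) ∧
      (∀ (a x : Fin 4 → K), ∑ r, c r * v₀' r * t r (a, 0) (0, x) = 0) := by
    rcases scalar_block_dichotomy c tS hJS v₀' (fun b x => by
        obtain ⟨s, hs⟩ := hv₀' b x
        exact ⟨s, by rw [← hs]; funext r; exact htSap r b 0 x 0⟩) with hz | ⟨h1, h2, h3⟩
    · refine absurd (Finset.sum_eq_zero fun r _ => ?_) hne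
      have := hz b' zz r; rw [htSap] at this; rw [this]; ring
    · refine ⟨h1, fun b y => ?_, fun a x => ?_⟩
      · have := h2 b y; simpa only [htSap] using this
      · have := h3 a x; simpa only [htSap] using this
  obtain ⟨hQv', hB₂', hA₃'⟩ := hv0'facts
  have hlam : ∑ r, c r * v₀ r * v₀' r ≠ 0 := by
    obtain ⟨s, hs⟩ := hv₀ a' yy
    obtain ⟨s', hs'⟩ := hv₀' b' zz
    have e1 : ∀ r, t r (a', 0) (yy, 0) = s * v₀ r := fun r => by
      have := congr_fun hs r; simpa using this
    have e2 : ∀ r, t r (0, b') (0, zz) = s' * v₀' r := fun r => by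
      have := congr_fun hs' r; simpa using this
    intro h0
    apply hne
    have : ∑ r, c r * t r (a', 0) (yy, 0) * t r (0, b') (0, zz) =
        s * s' * ∑ r, c r * v₀ r * v₀' r := by
      rw [Finset.mul_sum]; exact Finset.sum_congr rfl fun r _ => by rw [e1, e2]; ring
    rw [this, h0, mul_zero]
  let ν : (Fin 4 → K) →ₗ[K] (Fin 4 → K) →ₗ[K] (κ → K) :=
    LinearMap.mk₂ K (fun b y => fun r => t r (0, b) (y, 0))
      (fun b b' y => by
        funext r
        have : (((0 : Fin 4 → K), b + b') : (Fin 4 → K) × (Fin 4 → K)) = (0, b) + (0, b') := by simp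
        simp only [Pi.add_apply, this, map_add, LinearMap.add_apply])
      (fun s b y => by
        funext r
        have : (((0 : Fin 4 → K), s • b) : (Fin 4 → K) × (Fin 4 → K)) = s • (0, b) := by simp
        simp only [Pi.smul_apply, this, map_smul, LinearMap.smul_apply, smul_eq_mul])
      (fun b y y' => by
        funext r
        have : ((y + y', (0 : Fin 4 → K)) : (Fin 4 → K) × (Fin 4 → K)) = (y, 0) + (y', 0) := by simp
        simp only [Pi.add_apply, this, map_add])
      (fun s b y => by
        funext r
        have : ((s • y, (0 : Fin 4 → K)) : (Fin 4 → K) × (Fin 4 → K)) = s • (y, 0) := by simp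
        simp only [Pi.smul_apply, this, map_smul, smul_eq_mul])
  have hνap : ∀ b y r, ν b y r = t r (0, b) (y, 0) := fun b y r => rfl
  let μ : (Fin 4 → K) →ₗ[K] (Fin 4 → K) →ₗ[K] (κ → K) :=
    LinearMap.mk₂ K (fun a z => fun r => t r (a, 0) (0, z))
      (fun a a' z => by
        funext r
        have : ((a + a', (0 : Fin 4 → K)) : (Fin 4 → K) × (Fin 4 → K)) = (a, 0) + (a', 0) := by simp
        simp only [Pi.add_apply, this, map_add, LinearMap.add_apply])
      (fun s a z => by
        funext r
        have : ((s • a, (0 : Fin 4 → K)) : (Fin 4 → K) × (Fin 4 → K)) = s • (a, 0) := by simp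
        simp only [Pi.smul_apply, this, map_smul, LinearMap.smul_apply, smul_eq_mul])
      (fun a z z' => by
        funext r
        have : (((0 : Fin 4 → K), z + z') : (Fin 4 → K) × (Fin 4 → K)) = (0, z) + (0, z') := by simp
        simp only [Pi.add_apply, this, map_add])
      (fun s a z => by
        funext r
        have : (((0 : Fin 4 → K), s • z) : (Fin 4 → K) × (Fin 4 → K)) = s • (0, z) := by simp
        simp only [Pi.smul_apply, this, map_smul, smul_eq_mul])
  have hμap : ∀ a z r, μ a z r = t r (a, 0) (0, z) := fun a z r => rfl
  have hred := reduced_identity_of_scalar c t hJ v₀ v₀' hv₀ hv₀'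
  have hνiso : ∀ b y, ∑ r, c r * ν b y r * ν b y r = 0 := by
    intro b y
    have h := hred 0 b y 0
    simp only [t00, t00', add_zero, mul_zero, Finset.sum_const_zero, sub_zero,
      per_zero_row₀] at h
    rw [← h]
    exact Finset.sum_congr rfl fun r _ => by rw [hνap]; ring
  have hμiso : ∀ a z, ∑ r, c r * μ a z r * μ a z r = 0 := by
    intro a z
    have h := hred a 0 0 z
    simp only [t00, t00', zero_add, mul_zero, Finset.sum_const_zero, sub_zero,
      per_zero_row₂] at h
    rw [← h]
    exact Finset.sum_congr rfl fun r _ => by rw [hμap]; ring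
  have hX : ∀ a b y z, 2 * ∑ r, c r * ν b y r * μ a z r =
      (Matrix.of ![a, b, y, z]).permanent - 2 * ∑ r, c r * t r (a, 0) (y, 0) * t r (0, b) (0, z) := by
    intro a b y z
    have h := hred a b y z
    have e : ∑ r, c r * (t r (0, b) (y, 0) + t r (a, 0) (0, z)) ^ 2 =
        ∑ r, c r * ν b y r * ν b y r + ∑ r, c r * μ a z r * μ a z r +
          2 * ∑ r, c r * ν b y r * μ a z r := by
      rw [Finset.mul_sum, ← Finset.sum_add_distrib, ← Finset.sum_add_distrib]
      exact Finset.sum_congr rfl fun r _ => by rw [hνap, hμap]; ring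
    rw [e, hνiso, hμiso, zero_add, zero_add] at h
    exact h
  have hνν_b : ∀ b b' y, ∑ r, c r * ν b y r * ν b' y r = 0 := fun b b' y =>
    wdot_eq_zero_of_isotropic c _ _ (hνiso b y) (hνiso b' y)
      (by rw [← LinearMap.add_apply, ← map_add]; exact hνiso (b + b') y)
  have hνν_y : ∀ b y y', ∑ r, c r * ν b y r * ν b y' r = 0 := fun b y y' =>
    wdot_eq_zero_of_isotropic c _ _ (hνiso b y) (hνiso b y') (by rw [← map_add]; exact hνiso b (y + y'))
  have hν4 : ∀ b b' y y', ∑ r, c r * ν b y r * ν b' y' r + ∑ r, c r * ν b y' r * ν b' y r = 0 := by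
    intro b b' y y'
    have h := hνiso (b + b') (y + y')
    have hX : ν (b + b') (y + y') = ν b y + ν b y' + ν b' y + ν b' y' := by
      simp only [map_add, LinearMap.add_apply]; abel
    rw [hX, wdot_four, hνiso, hνiso, hνiso, hνiso, hνν_y b y y', hνν_b b b' y, hνν_b b b' y',
      hνν_y b' y y'] at h
    have h' : (2 : K) * (∑ r, c r * ν b y r * ν b' y' r + ∑ r, c r * ν b y' r * ν b' y r) = 0 := by
      linear_combination h
    exact (mul_eq_zero.1 h').resolve_left two_ne_zero
  -- ===== memo §2: spanning and the relations =====
  -- full cross pairings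
  have hcorr : ∀ a b y z : Fin 4, ∑ r, c r * t r (Pi.single a 1, 0) (Pi.single y 1, 0) *
      t r (0, Pi.single b 1) (0, Pi.single z 1) =
      (u₀ * (Pi.single a 1 : Fin 4 → K) 0 * (Pi.single y 1 : Fin 4 → K) 1 +
        w₀ * (Pi.single a 1 : Fin 4 → K) 1 * (Pi.single y 1 : Fin 4 → K) 0) *
      (u₁ * (Pi.single b 1 : Fin 4 → K) 0 * (Pi.single z 1 : Fin 4 → K) 1 +
        w₁ * (Pi.single b 1 : Fin 4 → K) 1 * (Pi.single z 1 : Fin 4 → K) 0) *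
      ∑ r, c r * v₀ r * v₀' r := by
    intro a b y z
    rw [Finset.mul_sum]
    exact Finset.sum_congr rfl fun r _ => by rw [hψ, hψ']; ring
  have hNMf : ∀ a b y z : Fin 4,
      ∑ r, c r * ν (Pi.single b 1) (Pi.single y 1) r * μ (Pi.single a 1) (Pi.single z 1) r =
      (if (a ≠ b ∧ a ≠ y ∧ a ≠ z ∧ b ≠ y ∧ b ≠ z ∧ y ≠ z) then (1 / 2 : K) else 0) -
      (u₀ * (Pi.single a 1 : Fin 4 → K) 0 * (Pi.single y 1 : Fin 4 → K) 1 +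
        w₀ * (Pi.single a 1 : Fin 4 → K) 1 * (Pi.single y 1 : Fin 4 → K) 0) *
      (u₁ * (Pi.single b 1 : Fin 4 → K) 0 * (Pi.single z 1 : Fin 4 → K) 1 +
        w₁ * (Pi.single b 1 : Fin 4 → K) 1 * (Pi.single z 1 : Fin 4 → K) 0) *
      ∑ r, c r * v₀ r * v₀' r := by
    intro a b y z
    have h := hX (Pi.single a 1) (Pi.single b 1) (Pi.single y 1) (Pi.single z 1)
    rw [per_basis, hcorr] at h
    split_ifs at h ⊢ <;> linear_combination h / 2
  have hv0v0 : ∑ r, c r * v₀ r * v₀ r = 0 := by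
    rw [← hQv]; exact Finset.sum_congr rfl fun r _ => by ring
  have hv0'v0' : ∑ r, c r * v₀' r * v₀' r = 0 := by
    rw [← hQv']; exact Finset.sum_congr rfl fun r _ => by ring
  have hli := linearIndependent_eleven_genswap c (fun b y => ν (Pi.single b 1) (Pi.single y 1))
    (fun a z => μ (Pi.single a 1) (Pi.single z 1)) v₀ v₀' u₀ w₀ u₁ w₁ hNMf
    (fun b y => by rw [wdot_comm]; exact hB₂ _ _) (fun b y => by rw [wdot_comm]; exact hB₂' _ _)
    (fun a z => hA₃ _ _) (fun a z => hA₃' _ _) hv0v0 hv0'v0' hu₀ hw₀ hu₁ hw₁ hloc hlam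
  have hcardκ : Fintype.card κ = 11 := by
    refine le_antisymm hκ ?_
    have h := hli.fintype_card_le_finrank
    simpa using h
  have hspan := hli.span_eq_top_of_card_eq_finrank' (by simp [hcardκ])
  obtain ⟨R20, R21, R31, R32⟩ := relations_of_span_genswap c
    (fun b y => ν (Pi.single b 1) (Pi.single y 1)) (fun a z => μ (Pi.single a 1) (Pi.single z 1))
    v₀ v₀' u₀ w₀ u₁ w₁ hNMf
    (fun b y => by rw [wdot_comm]; exact hB₂ _ _) (fun b y => by rw [wdot_comm]; exact hB₂' _ _)
    hc hspan
  exact false_of_relations_of_vanishing hκ c t hJ v₀ v₀' hv₀ hv₀' hpeel0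
    (by rintro a y (rfl | rfl) r <;> simp [hψ]) R20 R21 R31 R32

end Summit.ValiantsHypothesis.ValiantsHypothesis.Theorems.SymPencilPerFourPeeledCornerGenSwapSamePair

end
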